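import Summits.QuantumFields.BalabanUV.T4Continuum.Support.NE9LinSizeEndCurSpecies
import Summits.QuantumFields.BalabanUV.T4Continuum.Support.NE9Lemma1CurveSpeciesAdditive

/-!
# NE9LinSizeEndCurSpeciesAdd — E5′-CUR-ADD: the d-currency torus END face of row NE9 at the CURVE SPECIES on the analytic class with
ALL FOUR channel-structure binders S2 / S3 / S4 / S5 DISCHARGED BY THE KERNEL — E5′-CUR (`NE9LinSizeEndCurSpecies`, p214235, this
seat) with its one displayed structural binder `PieceAdditiveOn (analyticClass R) Dc.toC` SUPPLIED by crew row (w19)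
`NE9Lemma1CurveSpeciesAdditive.pieceAdditiveOn_cur` (leaf-08-g4, p214120) BY NAME; and the same at the DOUBLED chart of an ordinary
torus cube chart (`NE9DoubledChart`, p213930) — the E5′-REM-ADD (p213266) twin that crew row **(w21)-E5′** of the row owner's l.9603
asks for (cell `pub-balaban`, T4-DAG §2 node U3 / §6 NE9; rung (B)+1 on a FIXED finite T⁴; NE9 formalisation crew, unit
`b2b-balaban-t4-ne9-formalise-leaf-07` gen 5; nothing of any import modified, no END re-wired)

HONEST FRAMING (T4-DAG PAGE 1).  Rung (B)+1 = existence and uniqueness of the ε → 0 limit of gauge-invariant observables on a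
FIXED finite torus T⁴ — NOT infinite volume, NOT a mass gap, NOT the Clay problem.  NE9 is a cell NEW ESTIMATE, NOT PRINTED and
NOT discharged here («NE9 ⇐ the named binders»).  Everything kernel here is FORM-LEVEL: the species is the owner's `CurData.toC`
(the (1.23) contour functional of the fifth-order Taylor remainder of the complex old term along the displayed analytic SLICE
CURVES of [I] Lemma 4 (3.53), re/im-doubled carriers; LOCATED CORRECTION O-ne9p1g25-1); its identification with Bałaban's
(1.23)/(1.33) pieces is O-NE9-1 (NODE O), NOT claimed.  DISPLAYED on the channel side after this file (binders, never asserted):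
the datum's admissibility `CurData.Admissible` (κ₁ ≥ 1, radii, Lemma 4 TYPE ON THE CONTOURS: analytic slice curves into the ball,
ϱ > 1, gain ϱ⁻¹ ≤ c_dir·ℓ = (3.54)–(3.55), source discipline, G1 = [II] (1.25)); the SLICE-CURVE REGULARITY pair `hcurA` (the
analytic/MapsTo clause EVERYWHERE, not only on the contours — (w19)'s harmless convention) / `hcurC` (joint continuity of
`(t, s, σ, σ′) ↦ cur … t s σ σ′` on the unit slice circle) — TYPE [I] (3.53) / [II] (1.21)/(1.23); S1 `AdmissibleTerms E W
(analyticClass R)` ([I] (1.18) — TYPE); the [II] p. 8 level counts `LevelCountsG`; letters; `Factorises` / `LastCouplingLipschitz` at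
`cpieceChannel Dc.toC`; every activity / geometry / (A″) / (L‴) binder of E5′ VERBATIM.  NO abstract S-binder remains.  0 `def`,
0 `sorry`; [I]/[II] locators are TYPE locators (ABSOLUTE RULE); `FlowStep.BetaPertH`, (B), (B^μ) do not occur.
HONEST DEPENDENCY (verbatim): continuum YM on T⁴ ⇐ BetaPertH ∧ nine spine estimates (0/9 proved); BetaPertH ⇐ (D1) ∧ (D4) ∧
CAP+tail; G-an2-4 gates asym, D1 and NE2/3/4.

WHAT IS PROVED (kernel, `[folklore]` compositions BY NAME, 0 `def`).
§1 **E5′-CUR-ADD `torus_termSize_ne9_and_fadingMemory_of_linSizeDischargers_curSpeciesAdd`** = E5′-CUR (p214235 §1) with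
   `hA := pieceAdditiveOn_cur Dc (0 < κ₁ ⇐ hD.κ₁_ge) hD.r_pos hD.ϱ_gt hcurA hcurC`.  Conclusion VERBATIM E5′-CUR's / E5′-REM-ADD's:
   `TermSize ∧ NE9 E W κ (prodModuli ℓ fun _ => μ) ∧ FadingMemory (ℓ/μ) μ (…)`, **`μ = ω + 4·lipbar·(a₁·e^{−a″(ν+1)})·c_Q`**.
§2 **E5′-CUR-ADD-DBL `…_curSpeciesAdd_dbl`** = the same at the doubled chart `dblChart Γ` of an ORDINARY torus cube chart (p214235 §3
   with the same `hA`): chart binders `hXconn`/`hcmp` asked of `Γ` itself.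
DISGUISE TEST: one-history statements about a linear channel of ONE run at a FORM-level species; not NE9.

References (TYPE locators only; nothing printed is a hypothesis): T. Bałaban, CMP **109** (1987) [Balaban1987RG1] (1.18) p. 263,
(3.30) p. 276, (3.37) p. 277, Lemma 4 (3.53)–(3.55) p. 280; CMP **116** (1988) [Balaban1988RG2Cluster] (1.21)–(1.29) pp. 7–8, (1.33)
p. 9, (2.13) p. 14, (2.27) p. 18, (2.30) p. 18, (2.38) p. 20, (2.41) p. 21; R. Kotecký, D. Preiss, CMP **103** (1986) [KoteckyPreiss1986].
-/

noncomputable section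

namespace Summit.QuantumFields.BalabanUV.T4Continuum.NE9LinSizeEndCurSpeciesAdd

open scoped BigOperators
open Metric Set MeasureTheory BoundedContinuousFunction
open Literature.Probability.LatticeModels
open Literature.MathematicalPhysics.QuantumFieldTheory
open Literature.MathematicalPhysics.QuantumFieldTheory.Balaban1983to89
open Literature.MathematicalPhysics.QuantumFieldTheory.Balaban1983to89.T4OutputRate
open Literature.MathematicalPhysics.QuantumFieldTheory.Balaban1983to89.T4ActivityLipschitz
open Literature.MathematicalPhysics.QuantumFieldTheory.Balaban1983to89.T4HistoryLipschitzRecursion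
open Literature.MathematicalPhysics.QuantumFieldTheory.Balaban1983to89.T4HistoryLipschitzOuter
open Literature.MathematicalPhysics.QuantumFieldTheory.Balaban1983to89.T4HistoryLipschitzActivity
open Literature.MathematicalPhysics.QuantumFieldTheory.Balaban1983to89.T4HistoryLipschitzEntropy
open Literature.MathematicalPhysics.QuantumFieldTheory.Balaban1983to89.T4HistoryLipschitzCubeGeometry
open Literature.MathematicalPhysics.QuantumFieldTheory.Balaban1983to89.T4HistoryLipschitzActivity (ClusterGeom)
open Literature.MathematicalPhysics.QuantumFieldTheory.Balaban1983to89.T4HistoryLipschitzSegment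
open Literature.MathematicalPhysics.QuantumFieldTheory.Balaban1983to89.T4HistoryLipschitzLinearSize
open Summit.QuantumFields.BalabanUV.T4Continuum.NE9Lemma1Counting
open Summit.QuantumFields.BalabanUV.T4Continuum.NE9Lemma1Gain
open Summit.QuantumFields.BalabanUV.T4Continuum.NE9Lemma1PieceClass
open Summit.QuantumFields.BalabanUV.T4Continuum.NE9ComplexEncoding (doubleCarriers)
open Summit.QuantumFields.BalabanUV.T4Continuum.NE9Lemma1RemainderSpecies
open Summit.QuantumFields.BalabanUV.T4Continuum.NE9Lemma1CurveSpecies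
open Summit.QuantumFields.BalabanUV.T4Continuum.NE9Lemma1CurveSpeciesAdditive (pieceAdditiveOn_cur)
open Summit.QuantumFields.BalabanUV.T4Continuum.NE9LinSizeEnd
open Summit.QuantumFields.BalabanUV.T4Continuum.NE9LinSizeEndCPiece
open Summit.QuantumFields.BalabanUV.T4Continuum.NE9DoubledChart
open Summit.QuantumFields.BalabanUV.T4Continuum.NE9LinSizeEndCurSpecies

variable {ν N : ℕ} {C : Carriers} {D : ℕ}
variable {Bg : Type} [NormedAddCommGroup Bg] [NormedSpace ℂ Bg] {Sp : Type*} [TopologicalSpace Sp] [MeasurableSpace Sp]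
  [OpensMeasurableSpace Sp] {F : Type*} [Fintype F] {Ω : Type*} [MeasurableSpace Ω]

/-! ## §1 E5′-CUR-ADD: E5′ at the curve species with S2/S3/S4/S5 all kernel -/

/-- **E5′-CUR-ADD (kernel, composition BY NAME).**  E5′-CUR (p214235 §1) with its displayed additivity `hA : PieceAdditiveOn
(analyticClass Dc.R) Dc.toC` SUPPLIED by (w19)'s `pieceAdditiveOn_cur` (p214120; `0 < κ₁` from `hD.κ₁_ge`, `r_k > 0` from `hD.r_pos`,
`ϱ > 1` from `hD.ϱ_gt`).  DISPLAYED instead: the slice-curve regularity pair `hcurA`/`hcurC` (TYPE [I] Lemma 4 (3.53), [II]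
(1.21)/(1.23)).  Conclusion VERBATIM E5′-CUR's (rate letter `ω + 4·lipbar·(a₁·e^{−a″(ν+1)})·c_Q`).
[cite: Balaban1987RG1, (1.18) p.263, (3.53)-(3.54) p.280; Balaban1988RG2Cluster, (1.21)-(1.29) pp.7-8, (1.33) p.9, (2.27) p.18, (2.38) p.20, (2.41) p.21; KoteckyPreiss1986, (1)-(3)] -/
theorem torus_termSize_ne9_and_fadingMemory_of_linSizeDischargers_curSpeciesAdd
    (Γ : CubeChart (doubleCarriers C) (Fin ν → ZMod N) (torusAdj ν N) D) {ι αi βi γi δ : Type} [DecidableEq δ]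
    (Dc : CurData C Bg ι αi βi γi δ) {ℓr : ℕ → ℕ → ℝ} {cdir d0 : ℝ}
    {E : Functional (doubleCarriers C) Bg} {W : Set (ℕ → ℝ)}
    {Ψ : ℕ → ℝ → (ι → ℝ) → Bg → (doubleCarriers C).Dom → ℝ}
    {μ : ℕ → ℝ → Bg → Finset (Fin ν → ZMod N) → Measure Ω} {pre : ℕ → ℝ → Bg → Finset (Fin ν → ZMod N) → Ω → ℂ}
    {c : ℕ → ℝ → Bg → Finset (Fin ν → ZMod N) → Ω → F → ℂ}
    {pt : ℕ → ℝ → Bg → Finset (Fin ν → ZMod N) → Ω → F → Sp} {β : ℕ → Sp → ℝ}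
    {dom : ℕ → Finset (Fin ν → ZMod N) → F → Finset (Fin ν → ZMod N)}
    {lip ε' α4 : ℕ → ℝ} {a₁ a'' κ O1 cQ ω lipbar ℓ a a' : ℝ}
    {lam p₀ Nsz : ℕ → ℝ}
    (ρ : ℕ → (ι → ℝ) → (Sp →ᵇ ℂ))
    -- the CURVE SPECIES: its datum is admissible ([I] Lemma 4 (3.53) TYPE: analytic slice curves into the ball, ϱ > 1, gain,
    -- radii, G1), the scale letter ℓ ≥ 0
    (hD : Dc.Admissible ℓr cdir d0) (hℓr : ∀ k j, 0 ≤ ℓr k j)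
    -- S1 (the renormalised terms lie in the ANALYTIC class — [I] (1.18) p. 263, TYPE) and scale-zero freeness
    (h0 : ScaleZeroFree E W) (hAdm : AdmissibleTerms E W (analyticClass Dc.R))
    -- S3's residue: SLICE-CURVE REGULARITY (TYPE [I] Lemma 4 (3.53) p. 280, [II] (1.21)/(1.23) p. 7) — (w19) `pieceAdditiveOn_cur`
    (hcurA : ∀ k s y a b x t s' σ', DifferentiableOn ℂ (Dc.cur k s y a b x t s' σ') (ball 0 (Dc.ϱ k s y a b x)) ∧
      MapsTo (Dc.cur k s y a b x t s' σ') (ball 0 (Dc.ϱ k s y a b x)) (ball 0 (Dc.R x.1)))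
    (hcurC : ∀ k s y a b x, ContinuousOn
      (fun q : (ℂ × (δ → ℝ) × (δ → ℂ)) × ℂ => Dc.cur k s y a b x q.1.1 q.1.2.1 q.1.2.2 q.2) (univ ×ˢ sphere (0:ℂ) 1))
    -- the level counts of [II] p. 8 on the species' index frame, against `c_Q·ω^{k−j}` (displayed), and the letters
    (hLev : LevelCountsG Dc.toC.frame κ Dc.κ₁ O1 cQ (fun k j => ℓr k j ^ 5) (agePow ω))
    (hO1 : 0 ≤ O1) (hcQ : 0 ≤ cQ) (hω : 0 < ω)
    -- E5′'s remaining recursion-side binders at `T := cpieceChannel Dc.toC`, `wt := weightOf Dc.toC.frame Dc.κ₁ d0 O1 (Dc.Kp cdir)`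
    (hfac : Factorises E W (cpieceChannel Dc.toC) Ψ) (hlast : LastCouplingLipschitz E W (cpieceChannel Dc.toC) Ψ κ lam)
    (hρ : ∀ (k : ℕ) (Q Q' : ι → ℝ) (M : ℝ), (∀ y, |Q y - Q' y| ≤ weightOf Dc.toC.frame Dc.κ₁ d0 O1 (Dc.Kp cdir) k y * M) →
      ‖ρ k Q - ρ k Q'‖ ≤ M)
    (hΨ : ∀ (k : ℕ) (s : ℝ) (Q Q' : ι → ℝ) (U : Bg) (X : (doubleCarriers C).Dom),
      Ψ k s Q U X - Ψ k s Q' U X =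
        (Γ.geom.newTerm (Γ.geom.avgExpLinearAct μ pre fun k s U γ ω => evalFunctional (c k s U γ ω) (pt k s U γ ω))
            k s U X (ρ k Q) -
          Γ.geom.newTerm (Γ.geom.avgExpLinearAct μ pre fun k s U γ ω => evalFunctional (c k s U γ ω) (pt k s U γ ω))
            k s U X (ρ k Q')).re)
    (hexpl : ∀ g ∈ W, ∀ (k : ℕ) (Q : ι → ℝ) (U : Bg) (X : (doubleCarriers C).Dom), (doubleCarriers C).scale X = k + 1 →
      |Ψ k (g k) Q U X -
          (Γ.geom.newTerm (Γ.geom.avgExpLinearAct μ pre fun k s U γ ω => evalFunctional (c k s U γ ω) (pt k s U γ ω))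
            k (g k) U X (ρ k Q)).re| ≤ Real.exp (-(κ * (doubleCarriers C).d X)) * p₀ k)
    (hbase : ∀ g ∈ W, ∀ (U : Bg) (X : (doubleCarriers C).Dom), (doubleCarriers C).scale X = 0 →
      |E g U X| ≤ Real.exp (-(κ * (doubleCarriers C).d X)) * Nsz 0)
    (hNsucc : ∀ j, p₀ j + a₁ * Real.exp (-(a'' * (ν + 1))) ≤ Nsz (j + 1)) (hNnn : ∀ j, 0 ≤ Nsz j)
    (hbox : ∀ (k : ℕ) (Q : ι → ℝ),
      (∀ y, |Q y| ≤ weightOf Dc.toC.frame Dc.κ₁ d0 O1 (Dc.Kp cdir) k y * sizeRadius (tauOfG cQ (agePow ω)) Nsz k) →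
        ∀ x, ‖ρ k Q x‖ ≤ β k x)
    (hpre : ∀ k s U γ, AEStronglyMeasurable (pre k s U γ) (μ k s U γ))
    (hc : ∀ k s U γ Y, AEStronglyMeasurable (fun ω => c k s U γ ω Y) (μ k s U γ))
    (hpt : ∀ k s U γ Y, Measurable fun ω => pt k s U γ ω Y) (hlip : ∀ k, 0 < lip k) (hlipb : ∀ k, lip k ≤ lipbar)
    (hint₀ : ∀ k s U γ, Integrable (fun ω => ‖pre k s U γ ω‖ * Real.exp (boxExponent c pt β k s U γ ω)) (μ k s U γ))
    (hmeet : ∀ k s U (γ : Finset (Fin ν → ZMod N)) ω Y, c k s U γ ω Y ≠ 0 → ∃ x ∈ γ, x ∈ dom k γ Y)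
    (hα4 : ∀ k, 0 ≤ α4 k) (ha : (2:ℝ) ^ ν * Real.log 2 + Real.log (8 * ν) ≤ a)
    (hliplb : ∀ k, α4 k * 2 ^ (ν + 1 + 2 ^ ν) ≤ lip k)
    (hlin : ∀ k s U (γ : Finset (Fin ν → ZMod N)) ω Y,
      ‖c k s U γ ω Y‖ ≤ α4 k * Real.exp (-(a * (linSize (dom k γ Y) : ℝ))))
    (hdomconn : ∀ k (γ : Finset (Fin ν → ZMod N)) Y, (dom k γ Y).Nonempty →
      ∃ b ∈ dom k γ Y, Polymer.IsConn (torusAdj ν N) (dom k γ Y) b)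
    (hdominj : ∀ k (γ : Finset (Fin ν → ZMod N)), Set.InjOn (dom k γ) {Y | (dom k γ Y).Nonempty})
    (hXconn : ∀ X, ∃ b, Polymer.IsConn (torusAdj ν N) (Γ.cubes X) b)
    (hcmp : ∀ X, κ * (doubleCarriers C).d X ≤ a'' * (linSize (Γ.cubes X) : ℝ))
    (hε' : ∀ k, 0 ≤ ε' k)
    (hdecayLin : ∀ g ∈ W, ∀ (k : ℕ) (U : Bg) (X : (doubleCarriers C).Dom), (doubleCarriers C).scale X = k + 1 → ∀ γ' ∈ Γ.vol X,
      ∫ ω, ‖pre k (g k) U γ' ω‖ * Real.exp (boxExponent c pt β k (g k) U γ' ω) ∂(μ k (g k) U γ') ≤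
        ε' k * Real.exp (-(a' * (linSize γ' : ℝ))))
    (ha₁ : 0 ≤ a₁) (ha'' : 0 ≤ a'')
    (hrate : (2:ℝ) ^ ν * Real.log 2 + Real.log (8 * ν) ≤ a' - a'' - 2 ^ ν * (a₁ + Real.log 2))
    (hsmall : ∀ k, ((D : ℝ) + 1) * (2 * ε' k) * Real.exp (a'' * (ν + 1) + 2 ^ ν * (a₁ + Real.log 2)) *
      2 ^ (ν + 1 + 2 ^ ν) ≤ a₁)
    (hℓ : 0 ≤ ℓ) (hlam : ∀ k, lam k ≤ ℓ) :
    TermSize E W κ Nsz ∧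
      NE9 E W κ (prodModuli ℓ fun _ => ω + 4 * lipbar * (a₁ * Real.exp (-(a'' * (ν + 1)))) * cQ) ∧
        FadingMemory (ℓ / (ω + 4 * lipbar * (a₁ * Real.exp (-(a'' * (ν + 1)))) * cQ))
          (ω + 4 * lipbar * (a₁ * Real.exp (-(a'' * (ν + 1)))) * cQ)
          (prodModuli ℓ fun _ => ω + 4 * lipbar * (a₁ * Real.exp (-(a'' * (ν + 1)))) * cQ) :=
  torus_termSize_ne9_and_fadingMemory_of_linSizeDischargers_curSpecies Γ Dc ρ hD hℓr h0 hAdm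
    (pieceAdditiveOn_cur Dc (lt_of_lt_of_le one_pos hD.κ₁_ge) hD.r_pos hD.ϱ_gt hcurA hcurC) hLev hO1 hcQ hω hfac hlast hρ hΨ
    hexpl hbase hNsucc hNnn hbox hpre hc hpt hlip hlipb hint₀ hmeet hα4 ha hliplb hlin hdomconn hdominj hXconn hcmp hε' hdecayLin
    ha₁ ha'' hrate hsmall hℓ hlam

/-! ## §2 E5′-CUR-ADD-DBL: the same at the doubled chart of an ordinary torus cube chart -/

/-- **E5′-CUR-ADD-DBL (kernel, composition BY NAME).**  §1 at the doubled chart `dblChart Γ` of an ORDINARY torus cube chart `Γ`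
(p214235 §3 with `hA := pieceAdditiveOn_cur …`): activity data on `Γ`'s cube families, new term at the domain `X.1`, chart binders
`hXconn`/`hcmp` asked of `Γ` itself (LOCATED FINDING F-ne9leaf07g5-1).  Conclusion VERBATIM §1's.
[cite: Balaban1987RG1, p.257, (1.18) p.263, (3.53)-(3.54) p.280; Balaban1988RG2Cluster, (1.21)-(1.29) pp.7-8, (2.13) p.14, (2.27) p.18, (2.30) p.18, (2.38) p.20, (2.41) p.21; KoteckyPreiss1986, (1)-(3)] -/
theorem torus_termSize_ne9_and_fadingMemory_of_linSizeDischargers_curSpeciesAdd_dbl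
    (Γ : CubeChart C (Fin ν → ZMod N) (torusAdj ν N) D) {ι αi βi γi δ : Type} [DecidableEq δ]
    (Dc : CurData C Bg ι αi βi γi δ) {ℓr : ℕ → ℕ → ℝ} {cdir d0 : ℝ}
    {E : Functional (doubleCarriers C) Bg} {W : Set (ℕ → ℝ)}
    {Ψ : ℕ → ℝ → (ι → ℝ) → Bg → (doubleCarriers C).Dom → ℝ}
    {μ : ℕ → ℝ → Bg → Finset (Fin ν → ZMod N) → Measure Ω} {pre : ℕ → ℝ → Bg → Finset (Fin ν → ZMod N) → Ω → ℂ}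
    {c : ℕ → ℝ → Bg → Finset (Fin ν → ZMod N) → Ω → F → ℂ}
    {pt : ℕ → ℝ → Bg → Finset (Fin ν → ZMod N) → Ω → F → Sp} {β : ℕ → Sp → ℝ}
    {dom : ℕ → Finset (Fin ν → ZMod N) → F → Finset (Fin ν → ZMod N)}
    {lip ε' α4 : ℕ → ℝ} {a₁ a'' κ O1 cQ ω lipbar ℓ a a' : ℝ}
    {lam p₀ Nsz : ℕ → ℝ}
    (ρ : ℕ → (ι → ℝ) → (Sp →ᵇ ℂ))
    (hD : Dc.Admissible ℓr cdir d0) (hℓr : ∀ k j, 0 ≤ ℓr k j)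
    (h0 : ScaleZeroFree E W) (hAdm : AdmissibleTerms E W (analyticClass Dc.R))
    -- S3's residue: SLICE-CURVE REGULARITY (TYPE [I] Lemma 4 (3.53) p. 280, [II] (1.21)/(1.23) p. 7) — (w19) `pieceAdditiveOn_cur`
    (hcurA : ∀ k s y a b x t s' σ', DifferentiableOn ℂ (Dc.cur k s y a b x t s' σ') (ball 0 (Dc.ϱ k s y a b x)) ∧
      MapsTo (Dc.cur k s y a b x t s' σ') (ball 0 (Dc.ϱ k s y a b x)) (ball 0 (Dc.R x.1)))
    (hcurC : ∀ k s y a b x, ContinuousOn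
      (fun q : (ℂ × (δ → ℝ) × (δ → ℂ)) × ℂ => Dc.cur k s y a b x q.1.1 q.1.2.1 q.1.2.2 q.2) (univ ×ˢ sphere (0:ℂ) 1))
    (hLev : LevelCountsG Dc.toC.frame κ Dc.κ₁ O1 cQ (fun k j => ℓr k j ^ 5) (agePow ω))
    (hO1 : 0 ≤ O1) (hcQ : 0 ≤ cQ) (hω : 0 < ω)
    (hfac : Factorises E W (cpieceChannel Dc.toC) Ψ) (hlast : LastCouplingLipschitz E W (cpieceChannel Dc.toC) Ψ κ lam)
    (hρ : ∀ (k : ℕ) (Q Q' : ι → ℝ) (M : ℝ), (∀ y, |Q y - Q' y| ≤ weightOf Dc.toC.frame Dc.κ₁ d0 O1 (Dc.Kp cdir) k y * M) →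
      ‖ρ k Q - ρ k Q'‖ ≤ M)
    -- the new term at a copy (X, b) = the localized cluster sum at the domain X.1 over `Γ.geom`
    (hΨ : ∀ (k : ℕ) (s : ℝ) (Q Q' : ι → ℝ) (U : Bg) (X : (doubleCarriers C).Dom),
      Ψ k s Q U X - Ψ k s Q' U X =
        (Γ.geom.newTerm (Γ.geom.avgExpLinearAct μ pre fun k s U γ ω => evalFunctional (c k s U γ ω) (pt k s U γ ω))
            k s U X.1 (ρ k Q) -
          Γ.geom.newTerm (Γ.geom.avgExpLinearAct μ pre fun k s U γ ω => evalFunctional (c k s U γ ω) (pt k s U γ ω))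
            k s U X.1 (ρ k Q')).re)
    (hexpl : ∀ g ∈ W, ∀ (k : ℕ) (Q : ι → ℝ) (U : Bg) (X : (doubleCarriers C).Dom), (doubleCarriers C).scale X = k + 1 →
      |Ψ k (g k) Q U X -
          (Γ.geom.newTerm (Γ.geom.avgExpLinearAct μ pre fun k s U γ ω => evalFunctional (c k s U γ ω) (pt k s U γ ω))
            k (g k) U X.1 (ρ k Q)).re| ≤ Real.exp (-(κ * (doubleCarriers C).d X)) * p₀ k)
    (hbase : ∀ g ∈ W, ∀ (U : Bg) (X : (doubleCarriers C).Dom), (doubleCarriers C).scale X = 0 →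
      |E g U X| ≤ Real.exp (-(κ * (doubleCarriers C).d X)) * Nsz 0)
    (hNsucc : ∀ j, p₀ j + a₁ * Real.exp (-(a'' * (ν + 1))) ≤ Nsz (j + 1)) (hNnn : ∀ j, 0 ≤ Nsz j)
    (hbox : ∀ (k : ℕ) (Q : ι → ℝ),
      (∀ y, |Q y| ≤ weightOf Dc.toC.frame Dc.κ₁ d0 O1 (Dc.Kp cdir) k y * sizeRadius (tauOfG cQ (agePow ω)) Nsz k) →
        ∀ x, ‖ρ k Q x‖ ≤ β k x)
    (hpre : ∀ k s U γ, AEStronglyMeasurable (pre k s U γ) (μ k s U γ))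
    (hc : ∀ k s U γ Y, AEStronglyMeasurable (fun ω => c k s U γ ω Y) (μ k s U γ))
    (hpt : ∀ k s U γ Y, Measurable fun ω => pt k s U γ ω Y) (hlip : ∀ k, 0 < lip k) (hlipb : ∀ k, lip k ≤ lipbar)
    (hint₀ : ∀ k s U γ, Integrable (fun ω => ‖pre k s U γ ω‖ * Real.exp (boxExponent c pt β k s U γ ω)) (μ k s U γ))
    (hmeet : ∀ k s U (γ : Finset (Fin ν → ZMod N)) ω Y, c k s U γ ω Y ≠ 0 → ∃ x ∈ γ, x ∈ dom k γ Y)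
    (hα4 : ∀ k, 0 ≤ α4 k) (ha : (2:ℝ) ^ ν * Real.log 2 + Real.log (8 * ν) ≤ a)
    (hliplb : ∀ k, α4 k * 2 ^ (ν + 1 + 2 ^ ν) ≤ lip k)
    (hlin : ∀ k s U (γ : Finset (Fin ν → ZMod N)) ω Y,
      ‖c k s U γ ω Y‖ ≤ α4 k * Real.exp (-(a * (linSize (dom k γ Y) : ℝ))))
    (hdomconn : ∀ k (γ : Finset (Fin ν → ZMod N)) Y, (dom k γ Y).Nonempty →
      ∃ b ∈ dom k γ Y, Polymer.IsConn (torusAdj ν N) (dom k γ Y) b)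
    (hdominj : ∀ k (γ : Finset (Fin ν → ZMod N)), Set.InjOn (dom k γ) {Y | (dom k γ Y).Nonempty})
    -- THE TWO CHART BINDERS, ASKED OF THE ORDINARY CHART `Γ`
    (hXconn : ∀ X : C.Dom, ∃ b, Polymer.IsConn (torusAdj ν N) (Γ.cubes X) b)
    (hcmp : ∀ X : C.Dom, κ * C.d X ≤ a'' * (linSize (Γ.cubes X) : ℝ))
    (hε' : ∀ k, 0 ≤ ε' k)
    (hdecayLin : ∀ g ∈ W, ∀ (k : ℕ) (U : Bg) (X : (doubleCarriers C).Dom), (doubleCarriers C).scale X = k + 1 →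
      ∀ γ' ∈ Γ.vol X.1,
      ∫ ω, ‖pre k (g k) U γ' ω‖ * Real.exp (boxExponent c pt β k (g k) U γ' ω) ∂(μ k (g k) U γ') ≤
        ε' k * Real.exp (-(a' * (linSize γ' : ℝ))))
    (ha₁ : 0 ≤ a₁) (ha'' : 0 ≤ a'')
    (hrate : (2:ℝ) ^ ν * Real.log 2 + Real.log (8 * ν) ≤ a' - a'' - 2 ^ ν * (a₁ + Real.log 2))
    (hsmall : ∀ k, ((D : ℝ) + 1) * (2 * ε' k) * Real.exp (a'' * (ν + 1) + 2 ^ ν * (a₁ + Real.log 2)) *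
      2 ^ (ν + 1 + 2 ^ ν) ≤ a₁)
    (hℓ : 0 ≤ ℓ) (hlam : ∀ k, lam k ≤ ℓ) :
    TermSize E W κ Nsz ∧
      NE9 E W κ (prodModuli ℓ fun _ => ω + 4 * lipbar * (a₁ * Real.exp (-(a'' * (ν + 1)))) * cQ) ∧
        FadingMemory (ℓ / (ω + 4 * lipbar * (a₁ * Real.exp (-(a'' * (ν + 1)))) * cQ))
          (ω + 4 * lipbar * (a₁ * Real.exp (-(a'' * (ν + 1)))) * cQ)
          (prodModuli ℓ fun _ => ω + 4 * lipbar * (a₁ * Real.exp (-(a'' * (ν + 1)))) * cQ) :=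
  torus_termSize_ne9_and_fadingMemory_of_linSizeDischargers_curSpecies_dbl Γ Dc ρ hD hℓr h0 hAdm
    (pieceAdditiveOn_cur Dc (lt_of_lt_of_le one_pos hD.κ₁_ge) hD.r_pos hD.ϱ_gt hcurA hcurC) hLev hO1 hcQ hω hfac hlast hρ hΨ
    hexpl hbase hNsucc hNnn hbox hpre hc hpt hlip hlipb hint₀ hmeet hα4 ha hliplb hlin hdomconn hdominj hXconn hcmp hε' hdecayLin
    ha₁ ha'' hrate hsmall hℓ hlam

end Summit.QuantumFields.BalabanUV.T4Continuum.NE9LinSizeEndCurSpeciesAdd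

end
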